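import Mathlib
import Summits.ValiantsHypothesis.ValiantsHypothesis.Theorems.BarrierLeverSuccinctHittingSetsForVPSeparableCoeffThreeEngine
import Summits.ValiantsHypothesis.ValiantsHypothesis.Theorems.BarrierLeverSuccinctHittingSetsForVPStubSeparableCoeff
import HarnessLib

/-!
# Separable coefficient tensors at exponent 3, II (chain): the recurrence and the chain identities
(crux stmt-ValiantsHypothesis-14610 side; docket 8745/8749 of seat val-np-p5)

Three files (`…SeparableCoeffThreeEngine`, `…SeparableCoeffThreeChain`, `…SeparableCoeffThree`) prove:
for every `n ≥ 6` and every table of univariate coefficient sequences `c_l : ℕ → ℂ` (`l < n`)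
there is `Λ ∈ SmallCircuits ℂ n 3` (degree `≤ n`, fan-in-two size `≤ n³`) with
`coeff_μ Λ = ∏_l c_l(μ_l)` for every `|μ| ≤ n` (`separableCoeff_three`). The tree's
`stub_separableCoeff` has the same conclusion at exponent `8` (truncation by interpolation, no
sharing); here the degree-`≤ n` truncation `Λ = Σ_{d ≤ n} (∏_l G_l(x_l))_d`,
`G_l = Σ_{k ≤ n} c_l(k) x_l^k`, is computed by the truncated-product dynamic programme
`P_{i+1,d} = Σ_{k ≤ d} c_i(k) x_i^k P_{i,d-k}` (`P_{i,d}` = degree-`d` part of `∏_{l<i} G_l`), all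
entries sharing ONE circuit via the tree's chain bound `complexity_chain_le` (Bürgisser 2000,
Rem. 2.7). The table — powers `x_l^k`, rows `P_{i,·}` (`i = 1, …, n-1`), prefix sums
`S_j = Σ_{d ≤ j} P_{n-1,d}`, and the output `Λ = Σ_k c_{n-1}(k) x_{n-1}^k S_{n-k}` — is indexed by
the finite linear order `Idx n = Fin 3 ×ₗ (Fin n ×ₗ Fin (n+1))` (block, row, column); its sharp cost
is `n(n-1) + n + (n-2)n² + n + (2n-1) = n³ - n² + 3n - 1` (`(d-1)` products and `d` weighted
additions per middle entry); the files prove the cruder `≤ n³` for `n ≥ 6`.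

THIS FILE: the algebra of the dynamic programme (`piLT_succ`, `P_zero`, `P_succ` — the recurrence,
via the degree-`d` part of `a·b` for homogeneous `a` —, `P_one`, `trunc_eq`, `S_zero`, `S_succ`,
`coeff_trunc`, `totalDegree_trunc_le`) and the CHAIN IDENTITIES `tab t = step t (X, (tab s)_{s<t})`
for every index `t` (`tab_eq_aeval_step`; blocks `tabN_zero_eq` / `tabN_one_eq` / `tabN_two_eq`),
i.e. the hypothesis of the chain bound. No definitions.

Honest framing: 14610-side bookkeeping (the cost of FSV's Construction 25 in regime `d = n`);
consumers are the factorial polynomial / principal catalecticant minors at exponent `3` (tree: `8`);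
nothing here bears on the open cruxes or on `VP ≠ VNP`.

References: [ForbesShpilkaVolk2018] Construction 25, Fact 26; [Burgisser2000] Def. 2.1, Rem. 2.7.
-/

-- layout Summits/ValiantsHypothesis/ValiantsHypothesis forces the duplicated namespace component
set_option linter.dupNamespace false

noncomputable section

namespace Summit.ValiantsHypothesis.ValiantsHypothesis.Theorems.BarrierLever.SuccinctHittingSetsForVP

open Literature.Barriers.ValiantsHypothesis Literature.Computability.AlgebraicComplexity MvPolynomial

namespace SeparableCoeffThree

/-! ### B. The truncated product of univariates and its dynamic programme -/

section Algebra

variable {n : ℕ} (c : Fin n → ℕ → ℂ)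

/-- `Π_{<n}` is the full product. [folklore] -/
theorem piLT_n : piLT c n = ∏ l : Fin n, uni c l := by
  unfold piLT
  congr 1
  ext l
  simp

/-- `Π_{<i+1} = G_i · Π_{<i}`. [folklore] -/
theorem piLT_succ {i : ℕ} (hi : i < n) : piLT c (i + 1) = uni c ⟨i, hi⟩ * piLT c i := by
  unfold piLT
  have hfilter : Finset.univ.filter (fun l : Fin n => (l : ℕ) < i + 1) =
      insert (⟨i, hi⟩ : Fin n) (Finset.univ.filter (fun l : Fin n => (l : ℕ) < i)) := by
    ext l
    simp only [Finset.mem_filter, Finset.mem_univ, true_and, Finset.mem_insert, Fin.ext_iff]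
    omega
  rw [hfilter, Finset.prod_insert]
  simp

/-- The constant coefficient of `G_l` is `c_l(0)`. [folklore] -/
theorem constantCoeff_uni (l : Fin n) : constantCoeff (uni c l) = c l 0 := by
  unfold uni
  rw [map_sum, Finset.sum_eq_single 0]
  · simp
  · intro k _ hk
    simp [constantCoeff_X, zero_pow hk]
  · intro h; exact absurd (Finset.mem_range.mpr (Nat.succ_pos n)) h

/-- `P_{i,0} = ∏_{l<i} c_l(0)` (a constant). [folklore] -/
theorem P_zero (i : ℕ) :
    P c i 0 = C (∏ l ∈ Finset.univ.filter (fun l : Fin n => (l : ℕ) < i), c l 0) := by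
  unfold P piLT
  rw [homogeneousComponent_zero, ← constantCoeff_eq, map_prod]
  simp only [constantCoeff_uni]

/-- Degree-`d` part of `a · b` for `a` homogeneous of degree `i`: `a · b_{d-i}` if `i ≤ d`, else `0`.
[folklore] -/
theorem homogeneousComponent_mul_left {a b : MvPolynomial (Fin n) ℂ} {i : ℕ}
    (ha : a.IsHomogeneous i) (d : ℕ) :
    homogeneousComponent d (a * b) = if i ≤ d then a * homogeneousComponent (d - i) b else 0 := by
  -- adapted from Literature/AlgebraicGeometry/Hironaka2017/Lib/EdgeAlgebraGenerators.lean
  classical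
  have hb : b = ∑ j ∈ Finset.range (b.totalDegree + 1), homogeneousComponent j b :=
    (sum_homogeneousComponent b).symm
  have hterm : ∀ j, homogeneousComponent d (a * homogeneousComponent j b) =
      if d = i + j then a * homogeneousComponent j b else 0 := fun j =>
    homogeneousComponent_of_mem
      ((mem_homogeneousSubmodule _ _).mpr (ha.mul (homogeneousComponent_isHomogeneous j b)))
  have hsum : homogeneousComponent d (a * b) = ∑ j ∈ Finset.range (b.totalDegree + 1),
      (if d = i + j then a * homogeneousComponent j b else 0) := by
    conv_lhs => rw [hb, Finset.mul_sum]
    rw [map_sum]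
    exact Finset.sum_congr rfl fun j _ => hterm j
  rw [hsum]
  split_ifs with hle
  · rw [Finset.sum_eq_single (d - i)]
    · rw [if_pos (by omega)]
    · intro j _ hj
      rw [if_neg (by omega)]
    · intro hj
      rw [homogeneousComponent_eq_zero _ _
        (by have := Finset.mem_range.not.mp hj; omega), mul_zero, ite_self]
  · exact Finset.sum_eq_zero fun j _ => if_neg (by omega)

/-- **The recurrence**: `P_{i+1,d} = Σ_{k ≤ d} c_i(k) x_i^k · P_{i,d-k}` for `i < n`, `d ≤ n`.
[cite: ForbesShpilkaVolk2018, Construction 25] -/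
theorem P_succ {i : ℕ} (hi : i < n) {d : ℕ} (hd : d ≤ n) :
    P c (i + 1) d = ∑ k ∈ Finset.range (d + 1),
      (C (c ⟨i, hi⟩ k) * X (⟨i, hi⟩ : Fin n) ^ k) * P c i (d - k) := by
  unfold P
  rw [piLT_succ c hi, uni, Finset.sum_mul, map_sum]
  have hterm : ∀ k, homogeneousComponent d ((C (c ⟨i, hi⟩ k) * X (⟨i, hi⟩ : Fin n) ^ k) * piLT c i)
      = if k ≤ d then (C (c ⟨i, hi⟩ k) * X (⟨i, hi⟩ : Fin n) ^ k) *
          homogeneousComponent (d - k) (piLT c i) else 0 := fun k =>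
    homogeneousComponent_mul_left ((isHomogeneous_X_pow _ k).C_mul _) d
  simp only [hterm]
  rw [← Finset.sum_filter]
  congr 1
  ext k
  simp only [Finset.mem_filter, Finset.mem_range]
  omega

/-- The first row: `P_{1,d} = c_0(d) x_0^d` for `d ≤ n` (and `n ≥ 1`). [folklore] -/
theorem P_one (hn : 0 < n) {d : ℕ} (hd : d ≤ n) :
    P c 1 d = C (c ⟨0, hn⟩ d) * X (⟨0, hn⟩ : Fin n) ^ d := by
  rw [P_succ c hn hd, Finset.sum_eq_single d]
  · rw [Nat.sub_self, P_zero]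
    simp
  · intro k hk hkd
    have hk' : k < d := lt_of_le_of_ne (Nat.lt_succ_iff.mp (Finset.mem_range.mp hk)) hkd
    unfold P piLT
    rw [homogeneousComponent_eq_zero, mul_zero]
    have : Finset.univ.filter (fun l : Fin n => (l : ℕ) < 0) = ∅ := by ext; simp
    rw [this, Finset.prod_empty, totalDegree_one]
    omega
  · intro h; exact absurd (Finset.mem_range.mpr (Nat.lt_succ_self d)) h

/-- The last row regrouped: `Λ = Σ_{k ≤ n} c_{n-1}(k) x_{n-1}^k · S_{n-k}` (`n ≥ 1`). [folklore] -/
theorem trunc_eq (hn : 0 < n) :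
    trunc c = ∑ k ∈ Finset.range (n + 1),
      (C (c ⟨n - 1, by omega⟩ k) * X (⟨n - 1, by omega⟩ : Fin n) ^ k) * S c (n - k) := by
  unfold trunc
  have hn1 : n - 1 + 1 = n := by omega
  have hstep : ∀ d ∈ Finset.range (n + 1), P c n d = ∑ k ∈ Finset.range (d + 1),
      (C (c ⟨n - 1, by omega⟩ k) * X (⟨n - 1, by omega⟩ : Fin n) ^ k) * P c (n - 1) (d - k) := by
    intro d hd
    have h := P_succ c (i := n - 1) (by omega) (d := d)
      (Nat.lt_succ_iff.mp (Finset.mem_range.mp hd))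
    rwa [hn1] at h
  rw [Finset.sum_congr rfl hstep,
    Finset.sum_comm' (t' := Finset.range (n + 1)) (s' := fun k => Finset.Ico k (n + 1))]
  · refine Finset.sum_congr rfl fun k hk => ?_
    rw [S, Finset.mul_sum, Finset.sum_Ico_eq_sum_range]
    have hk' : n + 1 - k = n - k + 1 := by
      have := Finset.mem_range.mp hk; omega
    rw [hk']
    refine Finset.sum_congr rfl fun j _ => ?_
    rw [Nat.add_sub_cancel_left]
  · intro d k
    simp only [Finset.mem_range, Finset.mem_Ico]
    omega

/-- `S_0 = ∏_{l<n-1} c_l(0)` and `S_{j+1} = S_j + P_{n-1,j+1}`. [folklore] -/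
theorem S_zero : S c 0 = C (∏ l ∈ Finset.univ.filter (fun l : Fin n => (l : ℕ) < n - 1), c l 0) := by
  simp [S, P_zero]

/-- `S_{j+1} = S_j + P_{n-1,j+1}`. [folklore] -/
theorem S_succ (j : ℕ) : S c (j + 1) = S c j + P c (n - 1) (j + 1) := by
  rw [S, Finset.sum_range_succ, ← S]

/-- **Coefficients of the output**: `coeff_μ Λ = ∏_l c_l(μ_l)` for `|μ| ≤ n`.
[cite: ForbesShpilkaVolk2018, Fact 26] -/
theorem coeff_trunc (μ : Fin n →₀ ℕ) (hμ : μ.degree ≤ n) :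
    coeff μ (trunc c) = ∏ l, c l (μ l) := by
  unfold trunc P
  rw [coeff_sum, Finset.sum_eq_single_of_mem μ.degree (Finset.mem_range.mpr (by omega))]
  · rw [coeff_homogeneousComponent, if_pos rfl, piLT_n]
    exact SeparableCoeff.coeff_prod_univariate (n + 1) c μ fun l =>
      Nat.lt_succ_of_le ((Finsupp.le_degree l μ).trans hμ)
  · intro d _ hd
    rw [coeff_homogeneousComponent, if_neg (Ne.symm hd)]

/-- `deg Λ ≤ n`. [folklore] -/
theorem totalDegree_trunc_le : (trunc c).totalDegree ≤ n := by
  unfold trunc P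
  refine totalDegree_finsetSum_le fun d hd => ?_
  exact (homogeneousComponent_isHomogeneous d _).totalDegree_le.trans
    (Nat.lt_succ_iff.mp (Finset.mem_range.mp hd))

end Algebra

/-! ### C. The index order and the building blocks under the substitution -/

section Chain

variable {n : ℕ} (c : Fin n → ℕ → ℂ)

/-- Strict lexicographic comparison of indices, on the underlying naturals. [folklore] -/
theorem idx_lt_idx {a a' : Fin 3} {b b' : Fin n} {e e' : Fin (n + 1)}
    (h : (a : ℕ) < a' ∨ ((a : ℕ) = a' ∧ ((b : ℕ) < b' ∨ ((b : ℕ) = b' ∧ (e : ℕ) < e')))) :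
    idx a b e < idx a' b' e' := by
  simp only [idx, Prod.Lex.lt_iff, Fin.lt_def, Fin.ext_iff]
  rcases h with h | ⟨h1, h2 | ⟨h3, h4⟩⟩
  · exact Or.inl h
  · exact Or.inr ⟨h1, Or.inl h2⟩
  · exact Or.inr ⟨h1, Or.inr ⟨h3, h4⟩⟩

/-- `tab (idx a b e) = tabN a b e`. [folklore] -/
@[simp] theorem tab_idx (a : Fin 3) (b : Fin n) (e : Fin (n + 1)) :
    tab c (idx a b e) = tabN c a b e := by
  simp [tab, idx]

/-- `Y_{(a,b,e)} ↦ tabN a b e` when `(a, b, e)` precedes the current index `(a', b', e')`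
(indices as naturals, for `omega`). [folklore] -/
theorem aeval_yv {a' b' e' : ℕ} (ha' : a' < 3) (hb' : b' < n) (he' : e' < n + 1) {a b e : ℕ}
    (ha : a < 3) (hb : b < n) (he : e < n + 1)
    (hlt : a < a' ∨ (a = a' ∧ (b < b' ∨ (b = b' ∧ e < e')))) :
    aeval (subst c (idx ⟨a', ha'⟩ ⟨b', hb'⟩ ⟨e', he'⟩)) (yv a b e) = tabN c a b e := by
  unfold yv
  rw [dif_pos ⟨ha, hb, he⟩, aeval_X, subst, Sum.elim_inr, if_pos (idx_lt_idx hlt), tab_idx]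

/-- `x_b ↦ x_b`. [folklore] -/
theorem aeval_xin {t : Idx n} {b : ℕ} (hb : b < n) :
    aeval (subst c t) (xin b) = X (⟨b, hb⟩ : Fin n) := by
  unfold xin
  rw [dif_pos hb, aeval_X, subst, Sum.elim_inl]

end Chain

/-! ### D. The chain identities `tab t = step t (X, earlier entries)` -/

section Identities

variable {n : ℕ} (c : Fin n → ℕ → ℂ)

/-- `cN b k = c_b(k)` in range. [folklore] -/
theorem cN_eq {b : ℕ} (hb : b < n) (k : ℕ) : cN c b k = c ⟨b, hb⟩ k := by
  simp [cN, hb]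

/-- Block 0 (powers): `x_b^e` from `x_b^{e-1}`. [folklore] -/
theorem tabN_zero_eq (b : ℕ) (hb : b < n) (e : ℕ) (he : e < n + 1) :
    tabN c 0 b e = aeval (subst c (idx ⟨0, by norm_num⟩ ⟨b, hb⟩ ⟨e, he⟩)) (stepN c 0 b e) := by
  simp only [tabN, stepN, if_true, dif_pos hb]
  by_cases he0 : e = 0
  · simp [he0]
  · rw [if_neg he0]
    by_cases he1 : e = 1
    · rw [if_pos he1, aeval_xin c hb, he1, pow_one]
    · rw [if_neg he1, map_mul, aeval_xin c hb,
        aeval_yv c _ hb he (by norm_num) hb (by omega) (by omega)]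
      simp only [tabN, if_true, dif_pos hb]
      rw [← pow_succ']
      congr 1
      omega

/-- Block 1 (the rows `P_{b+1,·}`). [cite: ForbesShpilkaVolk2018, Construction 25] -/
theorem tabN_one_eq (b : ℕ) (hb : b < n) (e : ℕ) (he : e < n + 1) :
    tabN c 1 b e = aeval (subst c (idx ⟨1, by norm_num⟩ ⟨b, hb⟩ ⟨e, he⟩)) (stepN c 1 b e) := by
  have he' : e ≤ n := Nat.lt_succ_iff.mp he
  simp only [tabN, stepN, one_ne_zero, if_false, if_true]
  by_cases hbn : b + 2 ≤ n
  · rw [if_pos hbn, if_pos hbn]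
    by_cases hb0 : b = 0
    · -- first row: `P_{1,e} = c_0(e) x_0^e`
      rw [if_pos hb0]
      subst hb0
      rw [P_one c hb he']
      by_cases he0 : e = 0
      · subst he0
        rw [if_pos rfl, pow_zero, mul_one, aeval_C, algebraMap_eq, cN_eq c hb]
      · rw [if_neg he0, map_mul, aeval_C, algebraMap_eq, cN_eq c hb,
          aeval_yv c _ hb he (by norm_num) hb he (by omega)]
        simp only [tabN, if_true, dif_pos hb]
    · rw [if_neg hb0]
      by_cases he0 : e = 0
      · subst he0
        rw [if_pos rfl, aeval_C, algebraMap_eq, P_zero]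
        rfl
      · -- middle rows: the recurrence, last term folded
        rw [if_neg he0, map_sum, P_succ c (i := b) hb (d := e) he']
        refine Finset.sum_congr rfl fun k hk => ?_
        have hk : k ≤ e := Nat.lt_succ_iff.mp (Finset.mem_range.mp hk)
        have hb1 : b - 1 + 1 = b := by omega
        rw [map_smul, smul_eq_C_mul]
        simp only [coefP, termP]
        by_cases hk0 : k = 0
        · subst hk0
          rw [if_pos (Nat.pos_of_ne_zero he0), if_pos rfl, cN_eq c hb,
            aeval_yv c _ hb he (by norm_num) (by omega) he (by omega)]
          simp only [tabN, one_ne_zero, if_false, if_true]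
          rw [if_pos (by omega), hb1, pow_zero, mul_one, Nat.sub_zero]
        · rw [if_neg hk0]
          by_cases hke : k < e
          · rw [if_pos hke, if_pos hke, cN_eq c hb, map_mul,
              aeval_yv c _ hb he (by norm_num) hb (by omega) (by omega),
              aeval_yv c _ hb he (by norm_num) (by omega) (by omega) (by omega)]
            simp only [tabN, if_true, dif_pos hb, one_ne_zero, if_false]
            rw [if_pos (by omega), hb1, mul_assoc]
          · have hkeq : k = e := le_antisymm hk (not_lt.mp hke)
            subst hkeq
            rw [if_neg hke, if_neg hke, cN_eq c hb,
              aeval_yv c _ hb he (by norm_num) hb he (by omega), Nat.sub_self, P_zero]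
            simp only [tabN, if_true, dif_pos hb, c0prod, map_mul]
            ring
  · rw [if_neg hbn, if_neg hbn, map_zero]

/-- Block 2 (prefix sums and the output). [folklore] -/
theorem tabN_two_eq (hn : 2 ≤ n) (b : ℕ) (hb : b < n) (e : ℕ) (he : e < n + 1) :
    tabN c 2 b e = aeval (subst c (idx ⟨2, by norm_num⟩ ⟨b, hb⟩ ⟨e, he⟩)) (stepN c 2 b e) := by
  have he' : e ≤ n := Nat.lt_succ_iff.mp he
  simp only [tabN, stepN, (by norm_num : (2 : ℕ) ≠ 0), (by norm_num : (2 : ℕ) ≠ 1), if_false]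
  by_cases hb0 : b = 0
  · rw [if_pos hb0, if_pos hb0]
    by_cases he0 : e = 0
    · subst he0
      rw [if_pos rfl, aeval_C, algebraMap_eq, S_zero]
      rfl
    · rw [if_neg he0, map_add,
        aeval_yv c _ hb he (by norm_num) (by omega) (by omega) (by omega),
        aeval_yv c _ hb he (by norm_num) (by omega) he (by omega)]
      simp only [tabN, (by norm_num : (2 : ℕ) ≠ 0), (by norm_num : (2 : ℕ) ≠ 1), if_false,
        if_true, one_ne_zero]
      rw [if_pos (by omega), (by omega : n - 2 + 1 = n - 1)]
      obtain ⟨e', rfl⟩ : ∃ e', e = e' + 1 := ⟨e - 1, by omega⟩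
      rw [Nat.add_sub_cancel, S_succ]
  · rw [if_neg hb0, if_neg hb0]
    by_cases hb1 : b = 1 ∧ e = 0
    · -- the output
      rw [if_pos hb1, if_pos hb1, map_sum, trunc_eq c (by omega)]
      refine Finset.sum_congr rfl fun k hk => ?_
      have hk : k ≤ n := Nat.lt_succ_iff.mp (Finset.mem_range.mp hk)
      have hn1 : n - 1 < n := by omega
      rw [map_smul, smul_eq_C_mul]
      simp only [coefT, termT]
      by_cases hk0 : k = 0
      · subst hk0
        rw [if_pos (by omega), if_pos rfl, cN_eq c hn1,
          aeval_yv c _ hb he (by norm_num) (by omega) (by omega) (by omega)]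
        simp only [tabN, (by norm_num : (2 : ℕ) ≠ 0), (by norm_num : (2 : ℕ) ≠ 1), if_false,
          if_true, pow_zero, mul_one, Nat.sub_zero]
      · rw [if_neg hk0]
        by_cases hkn : k < n
        · rw [if_pos hkn, if_pos hkn, cN_eq c hn1, map_mul,
            aeval_yv c _ hb he (by norm_num) hn1 (by omega) (by omega),
            aeval_yv c _ hb he (by norm_num) (by omega) (by omega) (by omega)]
          simp only [tabN, if_true, dif_pos hn1, (by norm_num : (2 : ℕ) ≠ 0),
            (by norm_num : (2 : ℕ) ≠ 1), if_false, mul_assoc]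
        · have hkeq : k = n := le_antisymm hk (not_lt.mp hkn)
          subst hkeq
          rw [if_neg hkn, if_neg hkn, cN_eq c hn1,
            aeval_yv c _ hb he (by norm_num) hn1 (by omega) (by omega), Nat.sub_self, S_zero]
          simp only [tabN, if_true, dif_pos hn1, c0prod, map_mul]
          ring
    · rw [if_neg hb1, if_neg hb1, map_zero]

/-- **The chain identities**: every entry is its step evaluated at the inputs and the earlier
entries. [cite: Burgisser2000, Rem. 2.7] -/
theorem tab_eq_aeval_step (hn : 2 ≤ n) (t : Idx n) :
    tab c t = aeval (subst c t) (step c t) := by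
  obtain ⟨a, b, e, rfl⟩ : ∃ a b e, t = idx a b e :=
    ⟨(ofLex t).1, (ofLex (ofLex t).2).1, (ofLex (ofLex t).2).2, by simp [idx]⟩
  have hstep : step c (idx a b e) = stepN c a b e := by simp [step, idx]
  rw [tab_idx, hstep]
  fin_cases a
  · exact tabN_zero_eq c b b.isLt e e.isLt
  · exact tabN_one_eq c b b.isLt e e.isLt
  · exact tabN_two_eq c hn b b.isLt e e.isLt

end Identities

end SeparableCoeffThree

end Summit.ValiantsHypothesis.ValiantsHypothesis.Theorems.BarrierLever.SuccinctHittingSetsForVP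

end
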